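import Literature.MathematicalPhysics.QuantumFieldTheory.WilsonEnergyConvexity
import Literature.MathematicalPhysics.QuantumFieldTheory.YangMillsOS
import Literature.MathematicalPhysics.QuantumFieldTheory.StrongCouplingActivities
import HarnessLib

/-!
# Stub `stub_haarShiftSkew` of line `Sketch` (crux `stmt-QuantumFields-8760`)

Route `EquipartitionCriticality` of `YangMills`, crux item `stmt-QuantumFields-8760`
(`Summit.QuantumFields.YangMills.Theses.EquipartitionCriticality.EquipartitionPinsProbe`), line
`Sketch`, stub `stub_haarShiftSkew`: the one-link Haar-shift (finite-difference Schwinger–Dyson)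
identity for Wilson's torus measure with a *configuration-dependent* shift element.

What is proved (`stub_haarShiftSkew`): for every compact second-countable group `G`, continuous
matrix representation `ρ`, torus `(ℤ/L)^d`, coupling `β`, edge `e`, every MEASURABLE map
`γ : (E → G) → G` which does not read the coordinate `e` (`γ (update U e g) = γ U`), and every
real observable `f`,
`∫ f(update U e (γ(U)·U_e)) dμ_β = ∫ f(U) · exp(−β (S(update U e (γ(U)⁻¹·U_e)) − S(U))) dμ_β`,
together with its right-multiplication twin (`U_e ↦ U_e·γ(U)`, reweighting by the shift
`U_e ↦ U_e·γ(U)⁻¹`). The special case of a constant `γ ≡ g` is the tree's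
`haarShift_wilsonExpectation` (file `…EquipartitionPinsProbeHaarShift`).

Proof. Both sides are Gibbs averages `∫ X e^{−βS} dHaar^{⊗E} / Z`
(`wilsonExpectation_eq_integral_div`, valid for every `X`). The *skew shift*
`T(U) := update U e (k U (U e))` by a fibre map `k U : G → G` not reading `U e` acts on the
`e`-fibre through `x` by `g ↦ k x g` (`TangentHaarShiftSkew.skewShift_update`); hence, by Tonelli
over the single coordinate `e` (Mathlib `lintegral_eq_of_lmarginal_eq`, `lmarginal_singleton`), it
preserves the product measure `μ^{⊗E}` as soon as every `k x` preserves `μ`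
(`measurePreserving_skewShift` — the skew-product principle), and a fibrewise inverse `k'` inverts
it (`leftInverse_skewShift`). For `k U g = γ(U) g` (resp. `g γ(U)`) this is left (resp. right,
compact groups being unimodular: `haarProbability.instIsMulRightInvariant`) invariance of Haar
measure, and the change of variables `V = T U` (`MeasurePreserving.integral_comp'` for the
resulting measurable equivalence) plus telescoping of the Boltzmann factors gives the identity
(`integral_comp_wilsonMeasure`, `integral_skewShift_wilsonMeasure`). No measurability or
boundedness of `f` is needed: both sides are the same possibly-junk Bochner integral.
-/

noncomputable section

open MeasureTheory

namespace Summit.QuantumFields.YangMills.Theorems.EquipartitionPinsProbe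

namespace TangentHaarShiftSkew

open Literature.MathematicalPhysics.QuantumFieldTheory

section SkewShift

variable {ι : Type*} [DecidableEq ι] {G : Type*}

/-- When the fibre map `k U : G → G` does not read the coordinate `U e`, the skew shift
`U ↦ update U e (k U (U e))` acts on the `e`-fibre through `x` by `g ↦ k x g`. -/
theorem skewShift_update (e : ι) {k : (ι → G) → G → G}
    (hk : ∀ U g h, k (Function.update U e g) h = k U h) (x : ι → G) (g : G) :
    Function.update (Function.update x e g) e
        (k (Function.update x e g) (Function.update x e g e)) = Function.update x e (k x g) := by
  simp only [hk, Function.update_self, Function.update_idem]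

/-- A fibrewise left inverse `k'` of `k` (neither reading the coordinate `e`) makes the skew shift
by `k'` a left inverse of the skew shift by `k`. -/
theorem leftInverse_skewShift (e : ι) {k k' : (ι → G) → G → G}
    (hk' : ∀ U g h, k' (Function.update U e g) h = k' U h) (hinv : ∀ U g, k' U (k U g) = g) :
    Function.LeftInverse (fun U : ι → G => Function.update U e (k' U (U e)))
      fun U => Function.update U e (k U (U e)) := fun U => by
  simp only [hk', Function.update_self, Function.update_idem, hinv, Function.update_eq_self]

variable [MeasurableSpace G]

/-- The skew shift is measurable as soon as `k` is jointly measurable. -/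
theorem measurable_skewShift (e : ι) {k : (ι → G) → G → G}
    (hkm : Measurable (Function.uncurry k)) :
    Measurable fun U : ι → G => Function.update U e (k U (U e)) := by
  show Measurable ((fun p : (ι → G) × G => Function.update p.1 e p.2) ∘ fun U => (U, k U (U e)))
  exact measurable_update'.comp
    (measurable_id.prodMk (hkm.comp (measurable_id.prodMk (measurable_pi_apply e))))

/-- **Skew-product invariance of a product measure.** If the fibre maps `k U : G → G` do not read
the coordinate `U e`, `k` is jointly measurable and every `k x` preserves the σ-finite measure `μ`,
then the skew shift `U ↦ update U e (k U (U e))` preserves `μ^{⊗ι}`: by Tonelli over the single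
coordinate `e` (`lintegral_eq_of_lmarginal_eq`, `lmarginal_singleton`) it suffices that
`∫ F(update x e (k x g)) dμ(g) = ∫ F(update x e g) dμ(g)` for every `x` and measurable `F ≥ 0`. -/
theorem measurePreserving_skewShift [Fintype ι] (μ : Measure G) [SigmaFinite μ] (e : ι)
    {k : (ι → G) → G → G} (hk : ∀ U g h, k (Function.update U e g) h = k U h)
    (hkm : Measurable (Function.uncurry k)) (hμ : ∀ x, MeasurePreserving (k x) μ μ) :
    MeasurePreserving (fun U : ι → G => Function.update U e (k U (U e)))
      (Measure.pi fun _ : ι => μ) (Measure.pi fun _ : ι => μ) := by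
  refine ⟨measurable_skewShift e hkm, Measure.ext_of_lintegral _ fun F hF => ?_⟩
  rw [lintegral_map hF (measurable_skewShift e hkm)]
  refine lintegral_eq_of_lmarginal_eq {e} (hF.comp (measurable_skewShift e hkm)) hF ?_
  rw [lmarginal_singleton, lmarginal_singleton]
  funext x
  simp only [skewShift_update e hk]
  exact (hμ x).lintegral_comp (hF.comp (measurable_update x (a := e)))

end SkewShift

section Wilson

variable {G : Type*} [Group G] [TopologicalSpace G] [IsTopologicalGroup G] [CompactSpace G]
  [MeasurableSpace G] [BorelSpace G] {d L N : ℕ} [NeZero L]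

/-- **Change of variables in a Wilson–Gibbs average.** For every measurable bijection `T` of the
torus gauge configurations with measurable inverse `T'`, preserving the product Haar measure, and
EVERY real observable `f`, `∫ f(T U) dμ_β = ∫ f(U) · exp(−β (S(T' U) − S(U))) dμ_β`: both sides are
`∫ f(T U) e^{−β S(U)} dHaar^{⊗E} / Z` after the substitution `V = T U` in the right-hand numerator
(`MeasurePreserving.integral_comp'`) and telescoping of the Boltzmann factors. -/
theorem integral_comp_wilsonMeasure (ρ : G →* Matrix (Fin N) (Fin N) ℂ) (hρ : Continuous ρ) (β : ℝ)
    {T T' : GaugeConfig d L G → GaugeConfig d L G}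
    (hT : MeasurePreserving T (Measure.pi fun _ : Edge d L => haarProbability G)
      (Measure.pi fun _ : Edge d L => haarProbability G))
    (hT' : Measurable T') (h₁ : Function.LeftInverse T' T) (h₂ : Function.RightInverse T' T)
    (f : GaugeConfig d L G → ℝ) :
    ∫ U, f (T U) ∂(wilsonMeasure ρ β) =
      ∫ U, f U * Real.exp (-(β * (wilsonAction ρ (T' U) - wilsonAction ρ U)))
        ∂(wilsonMeasure ρ β) := by
  have hL := wilsonExpectation_eq_integral_div (d := d) (L := L) ρ hρ β (fun U => f (T U))
  have hR := wilsonExpectation_eq_integral_div (d := d) (L := L) ρ hρ β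
    (fun U => f U * Real.exp (-(β * (wilsonAction ρ (T' U) - wilsonAction ρ U))))
  unfold wilsonExpectation at hL hR
  rw [hL, hR]
  congr 1
  -- `T` as a measurable equivalence, and the change of variables `V = T U`
  let Te : GaugeConfig d L G ≃ᵐ GaugeConfig d L G :=
    { toFun := T
      invFun := T'
      left_inv := h₁
      right_inv := h₂
      measurable_toFun := hT.measurable
      measurable_invFun := hT' }
  have hTe : MeasurePreserving Te (Measure.pi fun _ : Edge d L => haarProbability G)
      (Measure.pi fun _ : Edge d L => haarProbability G) := hT
  rw [← hTe.integral_comp' (fun V => f V * Real.exp (-(β * (wilsonAction ρ (T' V) -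
    wilsonAction ρ V))) * Real.exp (-β * wilsonAction ρ V))]
  refine integral_congr_ae (ae_of_all _ fun U => ?_)
  have hU : (Te U : GaugeConfig d L G) = T U := rfl
  simp only [hU, h₁ U]
  rw [mul_assoc, ← Real.exp_add]
  congr 2
  ring

/-- **The skew Haar shift of one link.** For fibre maps `k U, k' U : G → G` which do not read the
coordinate `U e`, are jointly measurable and mutually inverse, and such that every `k x` preserves
the Haar probability measure, and for EVERY real observable `f`:
`∫ f(update U e (k U (U e))) dμ_β = ∫ f(U) · exp(−β (S(update U e (k' U (U e))) − S(U))) dμ_β`. -/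
theorem integral_skewShift_wilsonMeasure (ρ : G →* Matrix (Fin N) (Fin N) ℂ) (hρ : Continuous ρ)
    (β : ℝ) (e : Edge d L) (k k' : GaugeConfig d L G → G → G)
    (hk : ∀ U g h, k (Function.update U e g) h = k U h)
    (hk' : ∀ U g h, k' (Function.update U e g) h = k' U h)
    (h₁ : ∀ U g, k' U (k U g) = g) (h₂ : ∀ U g, k U (k' U g) = g)
    (hkm : Measurable (Function.uncurry k)) (hkm' : Measurable (Function.uncurry k'))
    (hμ : ∀ x, MeasurePreserving (k x) (haarProbability G) (haarProbability G))
    (f : GaugeConfig d L G → ℝ) :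
    ∫ U, f (Function.update U e (k U (U e))) ∂(wilsonMeasure ρ β) =
      ∫ U, f U * Real.exp (-(β * (wilsonAction ρ (Function.update U e (k' U (U e))) -
        wilsonAction ρ U))) ∂(wilsonMeasure ρ β) :=
  integral_comp_wilsonMeasure ρ hρ β
    (measurePreserving_skewShift (haarProbability G) e (k := k) hk hkm hμ)
    (measurable_skewShift e hkm') (leftInverse_skewShift e (k := k) (k' := k') hk' h₁)
    (leftInverse_skewShift e (k := k') (k' := k) hk h₂) f

end Wilson

end TangentHaarShiftSkew

/-- STUB `stub_haarShiftSkew` — **the one-link Haar-shift identity with a configuration-dependent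
shift element.** For Wilson's measure `μ_β ∝ e^{−βS} dHaar^{⊗E}` on the torus `(ℤ/L)^d`, an edge
`e`, a measurable `γ : (E → G) → G` not reading the coordinate `e`, and every real observable `f`:
`∫ f(update U e (γU·U_e)) dμ_β = ∫ f(U) · exp(−β (S(update U e (γU⁻¹·U_e)) − S(U))) dμ_β` and
`∫ f(update U e (U_e·γU)) dμ_β = ∫ f(U) · exp(−β (S(update U e (U_e·γU⁻¹)) − S(U))) dμ_β`
(left and right invariance of Haar measure in the coordinate `e`, as a skew product over the
remaining coordinates: `TangentHaarShiftSkew.integral_skewShift_wilsonMeasure`). -/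
theorem stub_haarShiftSkew :
    ∀ (G : Type) [Group G] [TopologicalSpace G] [IsTopologicalGroup G] [CompactSpace G]
      [SecondCountableTopology G] [MeasurableSpace G] [BorelSpace G] {N : ℕ}
      (ρ : G →* Matrix (Fin N) (Fin N) ℂ), Continuous ρ →
      ∀ (d L : ℕ) [NeZero L] (β : ℝ) (e : Literature.MathematicalPhysics.QuantumFieldTheory.Edge d L) (γ : Literature.MathematicalPhysics.QuantumFieldTheory.GaugeConfig d L G → G),
        Measurable γ → (∀ (U : Literature.MathematicalPhysics.QuantumFieldTheory.GaugeConfig d L G) (g : G), γ (Function.update U e g) = γ U) →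
        ∀ f : Literature.MathematicalPhysics.QuantumFieldTheory.GaugeConfig d L G → ℝ,
          (∫ U, f (Function.update U e (γ U * U e)) ∂(Literature.MathematicalPhysics.QuantumFieldTheory.wilsonMeasure (d := d) (L := L) ρ β) =
            ∫ U, f U * Real.exp (-(β * (Literature.MathematicalPhysics.QuantumFieldTheory.wilsonAction (d := d) (L := L) ρ
                (Function.update U e ((γ U)⁻¹ * U e)) - Literature.MathematicalPhysics.QuantumFieldTheory.wilsonAction (d := d) (L := L) ρ U)))
              ∂(Literature.MathematicalPhysics.QuantumFieldTheory.wilsonMeasure (d := d) (L := L) ρ β)) ∧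
          (∫ U, f (Function.update U e (U e * γ U)) ∂(Literature.MathematicalPhysics.QuantumFieldTheory.wilsonMeasure (d := d) (L := L) ρ β) =
            ∫ U, f U * Real.exp (-(β * (Literature.MathematicalPhysics.QuantumFieldTheory.wilsonAction (d := d) (L := L) ρ
                (Function.update U e (U e * (γ U)⁻¹)) - Literature.MathematicalPhysics.QuantumFieldTheory.wilsonAction (d := d) (L := L) ρ U)))
              ∂(Literature.MathematicalPhysics.QuantumFieldTheory.wilsonMeasure (d := d) (L := L) ρ β)) := by
  intro G _ _ _ _ _ _ _ N ρ hρ d L _ β e γ hγm hγe f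
  have hγ₁ : Measurable fun p : Literature.MathematicalPhysics.QuantumFieldTheory.GaugeConfig d L G × G => γ p.1 :=
    hγm.comp measurable_fst
  exact ⟨TangentHaarShiftSkew.integral_skewShift_wilsonMeasure ρ hρ β e (fun U h => γ U * h)
      (fun U h => (γ U)⁻¹ * h) (fun U g h => congrArg (· * h) (hγe U g))
      (fun U g h => congrArg (·⁻¹ * h) (hγe U g)) (fun U g => inv_mul_cancel_left (γ U) g)
      (fun U g => mul_inv_cancel_left (γ U) g) (hγ₁.mul measurable_snd) (hγ₁.inv.mul measurable_snd)
      (fun x => measurePreserving_mul_left (Literature.MathematicalPhysics.QuantumFieldTheory.haarProbability G) (γ x)) f,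
    TangentHaarShiftSkew.integral_skewShift_wilsonMeasure ρ hρ β e (fun U h => h * γ U)
      (fun U h => h * (γ U)⁻¹) (fun U g h => congrArg (h * ·) (hγe U g))
      (fun U g h => congrArg (h * ·⁻¹) (hγe U g)) (fun U g => mul_inv_cancel_right g (γ U))
      (fun U g => inv_mul_cancel_right g (γ U)) (measurable_snd.mul hγ₁) (measurable_snd.mul hγ₁.inv)
      (fun x => measurePreserving_mul_right (Literature.MathematicalPhysics.QuantumFieldTheory.haarProbability G) (γ x)) f⟩

end Summit.QuantumFields.YangMills.Theorems.EquipartitionPinsProbe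

end
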